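import Literature.Topology.FourManifolds.FishtailDiscPolar
import Mathlib.Analysis.Calculus.InverseFunctionTheorem.ApproximatesLinearOn
import Mathlib.Analysis.Calculus.ContDiff.RCLike
import Mathlib.Analysis.SpecialFunctions.Complex.LogDeriv
import HarnessLib

/-!
# The chart switch on the vertical segment of Gompf's collar annulus

Infrastructure for the explicit fishtail neighbourhood in the proof of R. Gompf, *More
Cappell–Shaneson spheres are standard*, Algebr. Geom. Topol. 10 (2010), Theorem 2.1 (the named
fact `Literature.Topology.FourManifolds.gompf2010_framedTwist`). The collar annulus `A` joining
Gompf's disc `D` to the box `N` is described near the disc in the cap chart `d`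
(`FishtailCoordinates.lean`: `d = capPt ε n s`, inverse `n = capN ε d`, `s = capS d`) and near the
box in the physical affine coordinates `(n, s)`; the two descriptions of its tubular
neighbourhood are interpolated along the vertical segment `{d = d₀}` of `A`. This file provides
the interpolation and its injectivity:

* `Literature.Topology.FourManifolds.exists_injOn_linear_interp` — **the switch lemma**: if
  `Φ` is `C¹` at `0` with invertible derivative `N`, then for some `r > 0` every interpolant
  `(1 - m) N + m Φ`, `m ∈ [0, 1]`, is injective on the ball `B(0, r)` (each is a `C¹`-small
  perturbation of `N`: `ApproximatesLinearOn.injOn`);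
* `Literature.Topology.FourManifolds.capPhi ε n_j` — the cap chart read in physical coordinates
  about the puncture `d₀ = capPt ε n_j (3/4) = -i t_j`:
  `δ ↦ (capN ε (d₀ + δ) - n_j, capS (d₀ + δ) - 3/4)`, with `capPhi 0 = 0`;
* `Literature.Topology.FourManifolds.capJ ε n_j : ℂ ≃L[ℝ] ℝ × ℝ` — its derivative at `0`,
  `δ ↦ (c_L im δ, re δ / (2π t_j))`, `c_L = ε / ((1 + t_j²) √(1 + t_j²)) = -capLat′(t_j)`
  (`hasFDerivAt_capPhi`), with explicit inverse;
* `Literature.Topology.FourManifolds.exists_injOn_capSwitch` — the interpolants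
  `(1 - m) capJ + m capPhi` are injective on a ball about `0`, uniformly in `m ∈ [0, 1]`.

Everything is proved; no named facts.

## References

* R. E. Gompf, *More Cappell–Shaneson spheres are standard*, Algebr. Geom. Topol. 10 (2010)
  1665–1681, proof of Thm 2.1 (the collar `[1, 2] × ∂F` joining `F` to `N`). [GompfAGT2010]
-/

noncomputable section

open scoped Real ContDiff Topology NNReal
open Set Function Complex Filter Metric

namespace Literature.Topology.FourManifolds

/-! ### The switch lemma -/

section Switch

variable {E F : Type*} [NormedAddCommGroup E] [NormedSpace ℝ E] [NormedAddCommGroup F]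
  [NormedSpace ℝ F]

/-- **The switch lemma.** If `Φ` is `C¹` at `0` with derivative the invertible map `N`, then on a
small ball every interpolant `(1 - m) N + m Φ` (`0 ≤ m ≤ 1`) is injective. [folklore] -/
theorem exists_injOn_linear_interp (N : E ≃L[ℝ] F) {Φ : E → F} (hΦ : ContDiffAt ℝ 1 Φ 0)
    (hd : HasFDerivAt Φ (N : E →L[ℝ] F) 0) :
    ∃ r > 0, ∀ m ∈ Icc (0 : ℝ) 1, InjOn (fun p ↦ (1 - m) • N p + m • Φ p) (ball 0 r) := by
  rcases subsingleton_or_nontrivial E with hE | hE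
  · exact ⟨1, one_pos, fun m _ ↦ (injective_of_subsingleton _).injOn⟩
  -- the perturbation `Q = Φ - N` has zero derivative at `0`
  set Q : E → F := fun p ↦ Φ p - N p with hQ
  have hQd : HasFDerivAt Q (0 : E →L[ℝ] F) 0 := by
    have h := hd.sub (N : E →L[ℝ] F).hasFDerivAt
    rwa [sub_self] at h
  have hQc : ContDiffAt ℝ 1 Q 0 := hΦ.sub (N : E →L[ℝ] F).contDiff.contDiffAt
  set K : ℝ≥0 := ‖(N.symm : F →L[ℝ] E)‖₊⁻¹ / 2 with hK
  have hNpos : 0 < ‖(N.symm : F →L[ℝ] E)‖₊ := N.nnnorm_symm_pos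
  have hKpos : 0 < K := by
    rw [hK]
    exact div_pos (inv_pos.2 hNpos) two_pos
  have hKlt : K < ‖(N.symm : F →L[ℝ] E)‖₊⁻¹ := by
    rw [hK]
    exact NNReal.half_lt_self (inv_pos.2 hNpos).ne'
  have hfd : ‖fderiv ℝ Q 0‖₊ < K := by
    rw [hQd.fderiv, nnnorm_zero]
    exact hKpos
  obtain ⟨t, ht, hL⟩ := hQc.exists_lipschitzOnWith_of_nnnorm_lt K hfd
  obtain ⟨r, hr, hrt⟩ := Metric.mem_nhds_iff.1 ht
  refine ⟨r, hr, fun m hm ↦ ?_⟩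
  have hL' := (lipschitzOnWith_iff_norm_sub_le.1 (hL.mono hrt))
  have happ : ApproximatesLinearOn (fun p ↦ (1 - m) • N p + m • Φ p) (N : E →L[ℝ] F) (ball 0 r) K := by
    intro x hx y hy
    have h1 : (1 - m) • N x + m • Φ x - ((1 - m) • N y + m • Φ y) - (N : E →L[ℝ] F) (x - y) =
        m • (Q x - Q y) := by
      simp only [hQ, ContinuousLinearEquiv.coe_coe, map_sub, smul_sub]
      module
    rw [h1, norm_smul, Real.norm_eq_abs, abs_of_nonneg hm.1]
    calc m * ‖Q x - Q y‖ ≤ 1 * ‖Q x - Q y‖ := by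
          gcongr
          exact hm.2
      _ ≤ K * ‖x - y‖ := by rw [one_mul]; exact hL' hx hy
  exact happ.injOn (Or.inr hKlt)

end Switch

/-! ### The cap chart in physical coordinates about the puncture -/

section Cap

variable (ε nj : ℝ)

/-- The chart radius of the puncture `t_j = capRad ε n_j`. [folklore] -/
def capTj : ℝ := capRad ε nj

/-- The puncture in the cap chart `d₀ = capPt ε n_j (3/4) = -i t_j`. [folklore] -/
def capD0 : ℂ := capPt ε nj (3 / 4)

/-- The slope constant `c_L = ε / ((1 + t_j²) √(1 + t_j²)) = -capLat′(t_j) > 0`. [folklore] -/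
def capCL : ℝ := ε / ((1 + capTj ε nj ^ 2) * Real.sqrt (1 + capTj ε nj ^ 2))

/-- **The cap chart in physical coordinates about the puncture**:
`capPhi δ = (capN ε (d₀ + δ) - n_j, capS (d₀ + δ) - 3/4)`. [folklore] -/
def capPhi (δ : ℂ) : ℝ × ℝ := (capN ε (capD0 ε nj + δ) - nj, capS (capD0 ε nj + δ) - 3 / 4)

/-- The linear part `δ ↦ (c_L im δ, re δ / (2π t_j))` as a continuous linear map. [folklore] -/
def capJL : ℂ →L[ℝ] ℝ × ℝ :=
  (capCL ε nj • imCLM).prod ((1 / (2 * π * capTj ε nj)) • reCLM)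

/-- Its inverse `(a, b) ↦ 2π t_j b + i a / c_L`. [folklore] -/
def capJLinv : ℝ × ℝ →L[ℝ] ℂ :=
  ((2 * π * capTj ε nj) • ofRealCLM).comp (ContinuousLinearMap.snd ℝ ℝ ℝ) +
    ((1 / capCL ε nj) • (ofRealCLM.smulRight I : ℝ →L[ℝ] ℂ)).comp (ContinuousLinearMap.fst ℝ ℝ ℝ)

variable {ε nj}

/-- The value of `capJL`. [folklore] -/
@[simp] theorem capJL_apply (δ : ℂ) :
    capJL ε nj δ = (capCL ε nj * δ.im, 1 / (2 * π * capTj ε nj) * δ.re) := by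
  simp [capJL]

/-- The value of `capJLinv`. [folklore] -/
@[simp] theorem capJLinv_apply (p : ℝ × ℝ) :
    capJLinv ε nj p = (2 * π * capTj ε nj * p.2 : ℝ) + (1 / capCL ε nj * p.1 : ℝ) * I := by
  simp [capJLinv]
  ring

/-- `d₀ = -i t_j`. [folklore] -/
theorem capD0_eq : capD0 ε nj = -((capTj ε nj : ℂ) * I) := by
  rw [capD0, capPt, capTj]
  have h : (2 * (π : ℂ) * ((3 / 4 : ℝ) : ℂ) * I) = ((3 * π / 2 : ℝ) : ℂ) * I := by
    push_cast; ring
  rw [h, exp_mul_I]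
  have hc : Complex.cos ((3 * π / 2 : ℝ) : ℂ) = 0 := by
    rw [← ofReal_cos]
    have : Real.cos (3 * π / 2) = 0 := by
      rw [show 3 * π / 2 = π / 2 + π by ring, Real.cos_add_pi, Real.cos_pi_div_two, neg_zero]
    simp [this]
  have hs : Complex.sin ((3 * π / 2 : ℝ) : ℂ) = -1 := by
    rw [← ofReal_sin]
    have : Real.sin (3 * π / 2) = -1 := by
      rw [show 3 * π / 2 = π / 2 + π by ring, Real.sin_add_pi, Real.sin_pi_div_two]
    simp [this]
  rw [hc, hs]
  ring

section

variable {hε : 0 < ε} {hnj : nj ^ 2 < ε ^ 2} {hnj0 : nj < 0}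

/-- `t_j > 0`. [folklore] -/
theorem capTj_pos (hnj : nj ^ 2 < ε ^ 2) (hnj0 : nj < 0) : 0 < capTj ε nj := capRad_pos hnj hnj0

/-- `c_L > 0`. [folklore] -/
theorem capCL_pos (hε : 0 < ε) : 0 < capCL ε nj := by
  unfold capCL
  have h1 : 0 < 1 + capTj ε nj ^ 2 := by positivity
  have h2 : 0 < Real.sqrt (1 + capTj ε nj ^ 2) := Real.sqrt_pos.2 h1
  positivity

/-- `re d₀ = 0`. [folklore] -/
theorem capD0_re : (capD0 ε nj).re = 0 := by
  rw [capD0_eq]; simp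

/-- `im d₀ = -t_j`. [folklore] -/
theorem capD0_im : (capD0 ε nj).im = -capTj ε nj := by
  rw [capD0_eq]; simp

/-- `re d₀⁻¹ = 0`. [folklore] -/
theorem capD0_inv_re : ((capD0 ε nj)⁻¹).re = 0 := by
  rw [inv_re, capD0_re, zero_div]

/-- `im d₀⁻¹ = 1/t_j`. [folklore] -/
theorem capD0_inv_im (hnj : nj ^ 2 < ε ^ 2) (hnj0 : nj < 0) : ((capD0 ε nj)⁻¹).im = (capTj ε nj)⁻¹ := by
  have ht := (capTj_pos hnj hnj0).ne'
  rw [inv_im, capD0_im, normSq_apply, capD0_re, capD0_im]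
  field_simp
  ring

/-- `‖d₀‖ = t_j`. [folklore] -/
theorem norm_capD0 (hnj : nj ^ 2 < ε ^ 2) (hnj0 : nj < 0) : ‖capD0 ε nj‖ = capTj ε nj := by
  rw [capD0_eq, norm_neg, norm_mul, norm_I, mul_one, norm_real, Real.norm_eq_abs,
    abs_of_pos (capTj_pos hnj hnj0)]

/-- `d₀ ≠ 0`. [folklore] -/
theorem capD0_ne_zero (hnj : nj ^ 2 < ε ^ 2) (hnj0 : nj < 0) : capD0 ε nj ≠ 0 := by
  rw [← norm_pos_iff, norm_capD0 hnj hnj0]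
  exact capTj_pos hnj hnj0

/-- `d₀` lies in the slit plane. [folklore] -/
theorem capD0_mem_slitPlane (hnj : nj ^ 2 < ε ^ 2) (hnj0 : nj < 0) : capD0 ε nj ∈ slitPlane := by
  rw [capD0_eq]
  refine Or.inr ?_
  simp [(capTj_pos hnj hnj0).ne']

/-- `capPhi 0 = 0`. [folklore] -/
theorem capPhi_zero (hε : 0 < ε) (hnj : nj ^ 2 < ε ^ 2) (hnj0 : nj < 0) : capPhi ε nj 0 = 0 := by
  have h34 : (1 : ℝ) / 2 < 3 / 4 := by norm_num
  have h34' : (3 : ℝ) / 4 < 1 := by norm_num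
  simp only [capPhi, add_zero, capD0, capN_capPt hε hnj hnj0.le, capS_capPt hnj hnj0 h34 h34',
    sub_self, Prod.mk_zero_zero]

/-- `capJLinv` is a left inverse of `capJL`. [folklore] -/
theorem capJLinv_capJL (hε : 0 < ε) (hnj : nj ^ 2 < ε ^ 2) (hnj0 : nj < 0) (δ : ℂ) :
    capJLinv ε nj (capJL ε nj δ) = δ := by
  have ht := (capTj_pos hnj hnj0).ne'
  have hc := (capCL_pos (nj := nj) hε).ne'
  have hπ := Real.pi_pos.ne'
  rw [capJL_apply, capJLinv_apply]
  apply Complex.ext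
  · simp
    field_simp
  · simp
    field_simp

/-- `capJLinv` is a right inverse of `capJL`. [folklore] -/
theorem capJL_capJLinv (hε : 0 < ε) (hnj : nj ^ 2 < ε ^ 2) (hnj0 : nj < 0) (p : ℝ × ℝ) :
    capJL ε nj (capJLinv ε nj p) = p := by
  have ht := (capTj_pos hnj hnj0).ne'
  have hc := (capCL_pos (nj := nj) hε).ne'
  have hπ := Real.pi_pos.ne'
  rw [capJLinv_apply, capJL_apply]
  ext
  · simp
    field_simp
  · simp
    field_simp

end

section

variable (hε : 0 < ε) (hnj : nj ^ 2 < ε ^ 2) (hnj0 : nj < 0)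

/-- **The derivative of the cap chart at the puncture** as a continuous linear equivalence
`capJ : ℂ ≃L[ℝ] ℝ × ℝ`, `δ ↦ (c_L im δ, re δ / (2π t_j))`. [folklore] -/
def capJ : ℂ ≃L[ℝ] ℝ × ℝ :=
  ContinuousLinearEquiv.equivOfInverse (capJL ε nj) (capJLinv ε nj) (capJLinv_capJL hε hnj hnj0)
    (capJL_capJLinv hε hnj hnj0)

/-- The value of `capJ`. [folklore] -/
@[simp] theorem capJ_apply (δ : ℂ) :
    capJ hε hnj hnj0 δ = (capCL ε nj * δ.im, 1 / (2 * π * capTj ε nj) * δ.re) := by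
  rw [capJ, ContinuousLinearEquiv.equivOfInverse_apply, capJL_apply]

/-- `capJ` as a continuous linear map is `capJL`. [folklore] -/
theorem coe_capJ : (capJ hε hnj hnj0 : ℂ →L[ℝ] ℝ × ℝ) = capJL ε nj := rfl

include hnj hnj0 in
/-- **`capPhi` is smooth at `0`.** [folklore] -/
theorem contDiffAt_capPhi {n : ℕ∞} : ContDiffAt ℝ n (capPhi ε nj) 0 := by
  have h0 := capD0_ne_zero hnj hnj0
  have hsl := capD0_mem_slitPlane hnj hnj0
  have htr : ContDiff ℝ n fun δ : ℂ ↦ capD0 ε nj + δ := contDiff_const.add contDiff_id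
  have h1 : ContDiffAt ℝ n (fun δ : ℂ ↦ capN ε (capD0 ε nj + δ)) 0 := by
    have h : ContDiffAt ℝ n (capN ε) (capD0 ε nj + 0) := by
      rw [add_zero]; exact (contDiffAt_capN ε h0).of_le (by exact_mod_cast le_top)
    exact h.comp 0 htr.contDiffAt
  have h2 : ContDiffAt ℝ n (fun δ : ℂ ↦ capS (capD0 ε nj + δ)) 0 := by
    have h : ContDiffAt ℝ n capS (capD0 ε nj + 0) := by
      rw [add_zero]; exact (contDiffAt_capS hsl).of_le (by exact_mod_cast le_top)
    exact h.comp 0 htr.contDiffAt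
  exact (h1.sub contDiffAt_const).prodMk (h2.sub contDiffAt_const)

include hε hnj hnj0 in
/-- **The derivative of `capPhi` at `0` is `capJ`.** Computed through `log`: `|d| = e^{re log d}`,
`arg d = im log d`, `d log = d₀⁻¹ = i/t_j` at `d₀ = -i t_j`. [folklore] -/
theorem hasFDerivAt_capPhi : HasFDerivAt (capPhi ε nj) (capJ hε hnj hnj0 : ℂ →L[ℝ] ℝ × ℝ) 0 := by
  have h0 := capD0_ne_zero hnj hnj0
  have hsl := capD0_mem_slitPlane hnj hnj0
  have htj := capTj_pos hnj hnj0
  have hre0 := capD0_inv_re (ε := ε) (nj := nj)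
  have him0 := capD0_inv_im hnj hnj0
  -- the logarithm at `d₀`, precomposed with the translation
  have hlog : HasFDerivAt (fun δ : ℂ ↦ log (capD0 ε nj + δ)) ((capD0 ε nj)⁻¹ • (1 : ℂ →L[ℝ] ℂ)) 0 := by
    have h1 : HasFDerivAt log ((capD0 ε nj)⁻¹ • (1 : ℂ →L[ℝ] ℂ)) (capD0 ε nj + 0) := by
      rw [add_zero]; exact (hasStrictFDerivAt_log_real hsl).hasFDerivAt
    have h2 : HasFDerivAt (fun δ : ℂ ↦ capD0 ε nj + δ) (ContinuousLinearMap.id ℝ ℂ) 0 :=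
      (hasFDerivAt_id (0 : ℂ)).const_add (capD0 ε nj)
    have h := h1.comp (0 : ℂ) h2
    rwa [ContinuousLinearMap.comp_id] at h
  -- first component: `capLat ε (exp (re (log (d₀ + δ))))`
  have hre : HasFDerivAt (fun δ : ℂ ↦ (log (capD0 ε nj + δ)).re)
      (reCLM.comp ((capD0 ε nj)⁻¹ • (1 : ℂ →L[ℝ] ℂ))) 0 :=
    reCLM.hasFDerivAt.comp 0 hlog
  have hexp0 : Real.exp (log (capD0 ε nj + 0)).re = capTj ε nj := by
    rw [add_zero, log_re, Real.exp_log (norm_pos_iff.2 h0), norm_capD0 hnj hnj0]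
  have hexp : HasFDerivAt (fun δ : ℂ ↦ Real.exp (log (capD0 ε nj + δ)).re)
      (capTj ε nj • reCLM.comp ((capD0 ε nj)⁻¹ • (1 : ℂ →L[ℝ] ℂ))) 0 := by
    have h := (Real.hasDerivAt_exp _).comp_hasFDerivAt 0 hre
    rwa [hexp0] at h
  have hcap : HasFDerivAt (fun δ : ℂ ↦ capLat ε (Real.exp (log (capD0 ε nj + δ)).re))
      ((-ε / ((1 + capTj ε nj ^ 2) * Real.sqrt (1 + capTj ε nj ^ 2))) •
        (capTj ε nj • reCLM.comp ((capD0 ε nj)⁻¹ • (1 : ℂ →L[ℝ] ℂ)))) 0 := by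
    have h := (hasDerivAt_capLat ε (Real.exp (log (capD0 ε nj + 0)).re)).comp_hasFDerivAt 0 hexp
    rwa [hexp0] at h
  have hN : HasFDerivAt (fun δ : ℂ ↦ capN ε (capD0 ε nj + δ) - nj)
      ((-ε / ((1 + capTj ε nj ^ 2) * Real.sqrt (1 + capTj ε nj ^ 2))) •
        (capTj ε nj • reCLM.comp ((capD0 ε nj)⁻¹ • (1 : ℂ →L[ℝ] ℂ)))) 0 := by
    refine (hcap.congr_of_eventuallyEq ?_).sub_const nj
    have hne : ∀ᶠ δ : ℂ in 𝓝 0, capD0 ε nj + δ ≠ 0 := by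
      have hc : ContinuousAt (fun δ : ℂ ↦ capD0 ε nj + δ) 0 :=
        (continuous_const.add continuous_id).continuousAt
      have : capD0 ε nj + 0 ≠ 0 := by rwa [add_zero]
      exact hc.eventually_ne this
    filter_upwards [hne] with δ hδ
    show capN ε (capD0 ε nj + δ) = capLat ε (Real.exp (log (capD0 ε nj + δ)).re)
    rw [capN, log_re, Real.exp_log (norm_pos_iff.2 hδ)]
  -- second component: `arg (d₀ + δ) / (2π) + 1 - 3/4`
  have him : HasFDerivAt (fun δ : ℂ ↦ (log (capD0 ε nj + δ)).im)
      (imCLM.comp ((capD0 ε nj)⁻¹ • (1 : ℂ →L[ℝ] ℂ))) 0 :=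
    imCLM.hasFDerivAt.comp 0 hlog
  have hS : HasFDerivAt (fun δ : ℂ ↦ capS (capD0 ε nj + δ) - 3 / 4)
      ((1 / (2 * π)) • imCLM.comp ((capD0 ε nj)⁻¹ • (1 : ℂ →L[ℝ] ℂ))) 0 := by
    have h1 : (fun δ : ℂ ↦ capS (capD0 ε nj + δ) - 3 / 4) =
        fun δ ↦ (1 / (2 * π)) * (log (capD0 ε nj + δ)).im + (1 - 3 / 4) := by
      funext δ; rw [capS, log_im]; ring
    rw [h1]
    exact (him.const_mul (1 / (2 * π))).add_const _
  refine (hN.prodMk hS).congr_fderiv (ContinuousLinearMap.ext fun δ ↦ Prod.ext ?_ ?_)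
  · show (-ε / ((1 + capTj ε nj ^ 2) * Real.sqrt (1 + capTj ε nj ^ 2))) •
        (capTj ε nj • ((capD0 ε nj)⁻¹ * δ).re) = capCL ε nj * δ.im
    rw [mul_re, hre0, him0, capCL]
    simp only [smul_eq_mul, zero_mul, zero_sub]
    have h1 : 0 < 1 + capTj ε nj ^ 2 := by positivity
    have h2 : 0 < Real.sqrt (1 + capTj ε nj ^ 2) := Real.sqrt_pos.2 h1
    field_simp
  · show (1 / (2 * π)) • ((capD0 ε nj)⁻¹ * δ).im = 1 / (2 * π * capTj ε nj) * δ.re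
    rw [mul_im, hre0, him0]
    simp only [smul_eq_mul, zero_mul, zero_add]
    field_simp

include hε hnj hnj0 in
/-- **The chart switch is injective**: for some `r > 0` all the interpolants
`δ ↦ (1 - m) capJ δ + m capPhi δ`, `m ∈ [0, 1]`, are injective on `B(0, r)`. [folklore] -/
theorem exists_injOn_capSwitch :
    ∃ r > 0, ∀ m ∈ Icc (0 : ℝ) 1,
      InjOn (fun δ : ℂ ↦ (1 - m) • (capJ hε hnj hnj0 δ : ℝ × ℝ) + m • capPhi ε nj δ) (ball 0 r) :=
  exists_injOn_linear_interp (capJ hε hnj hnj0) (contDiffAt_capPhi hnj hnj0) (hasFDerivAt_capPhi hε hnj hnj0)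

end

end Cap

end Literature.Topology.FourManifolds
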